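import Literature.IUT.HodgeArakelov.LabCuspKitBridge
import HarnessLib

/-!
# [IUTchII] Def 2.3 (iii): when is the interface `LabCuspStructure C` inhabited? — NV-L6 row «LabCuspStructure»

S. Mochizuki, *Inter-universal Teichmüller Theory II*, kurims manuscript (Dec. 2020), §2, Def 2.3 (iii) p. 68
(«`LabCusp^±(Π_v) = LabCusp^±(†𝒟_v)` admits a natural action by `𝔽_l^×`, as well as a zero element `†η^0_v` and a
`±`-canonical element `†η^±_v` … [cf. [IUTchI], Definition 6.1, (iii)]»); *I* (May 2020) Def 6.1 (i) p. 155, (iii)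
pp. 156–157 [cite: Mochizuki2012, II Def 2.3 (iii) p.68; I Def 6.1 (i)(iii) pp.155–157]. abc-iut cell, L6 BY-NAME
queue, §F v1.18p «NV-L6 WAVE» (census HOME/staging/w5/w5-d114/INHABITATION-CENSUS-L6-v3.md §A: 0 producers), seat
abc-iut-w5-d028. PROOF-ONLY: witnesses built INSIDE theorem terms; no `def`/`instance`/`structure`.

abc-iut-L6-t1's `LabCuspStructure C` (`LabelClassesOfCusps.lean`) carries an `𝔽_l^×`-action `act`, `eta0`, `etaPM` and
ONE bijection `toFl : LabCusp^±(Π_v) ≃ 𝔽_l` (`toFl eta0 = 0`, `toFl etaPM = ±1`, `toFl (act a t) = a · toFl t`) on the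
group-theoretic label set `LabCuspPM C W.piV W.piPM`. Unlike `CuspidalInertiaData`, it is NOT inhabited over
arbitrary data: its existence is EQUIVALENT to the printed cardinality statement «`LabCusp^±(Π_v)` has exactly `l`
elements» — which depends on the tower `W` and on the cuspidal-inertia notion `C`. Kernel content of this file:

* `LabCuspStructure.nonempty_iff_nonempty_equiv` — `Nonempty (LabCuspStructure C) ↔ Nonempty (LabCusp^±(Π_v) ≃ 𝔽_l)`
  (→ the field `toFl`; ← transport the regular `𝔽_l^×`-action, `0` and `1` along any bijection). So the NV row
  REDUCES EXACTLY to «`|LabCusp^±(Π_v)| = l`» for the pair `(W, C)`.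
* `LabCuspStructure.exists_kitAgreement_of_equiv` — GENUINE RELATIVE TO [IUTchI] Def 6.1 (iii): given the
  identification of label sets `LabCusp^±(Π_v) ≃ LabCusp^±(†𝒟_v)` with abc-iut-L5-t4's kit labels at an isomorph
  `X ≅ 𝒟_v` (MERGE-MAP row 99, the datum `e` of abc-iut-L6's `LabCuspStructure.KitAgreement`), there EXISTS an
  `L : LabCuspStructure C` TOGETHER WITH a `KitAgreement` for it — its `toFl` is a chart of the kit's `𝔽_l^±`-group
  `K.labPM v X hX`, so by `LabCuspKitBridge` its `𝔽_l^×`-action / `η^0` / `η^±` ARE the ones of [IUTchI] Def 6.1 (iii).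
* `LabCuspStructure.not_nonempty_of_subsingleton` — conversely, if `LabCusp^±(Π_v)` has at most one element (e.g.
  for a cuspidal-inertia notion with a single inertia group) and `l ≥ 2`, NO `LabCuspStructure C` exists: the row is
  genuinely conditional on `(W, C)`, not vacuously fillable.

NV-BLOCKED (absolute form), recorded: an absolute producer needs a tower `W : PlusMinusTower T` (NV-L6 row
«PlusMinusTower», another seat) with a `CuspidalInertiaData` whose `Π_v`-label classes number `l` — i.e. the
[IUTchI] §2 / [CombGC] cusp combinatorics of `X̲̲_v → X_v`; until then consumers keep `L : LabCuspStructure C` as data.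
Nothing of the series is asserted; no side taken on [IUTchIII] Cor 3.12.
-/

namespace Literature.IUT.HodgeArakelov

open Literature.IUT.HodgeTheaters

universe u

variable {S : BadPlaceSetting.{u}} {P : TopGroup.{u}} {T : TemperedCoverings S P} {W : PlusMinusTower T}
  {C : CuspidalInertiaData W}

namespace LabCuspStructure

/-- **IUTchII:Def2.3(iii)** (kurims p.68) `LabCuspStructure C` is inhabited IFF the label set `LabCusp^±(Π_v)` is in
bijection with `𝔽_l` («…determine a single … conjugacy class …; … of cardinality one» ⇒ `l` classes, [IUTchI] Def 6.1
(iii)): → is the field `toFl`; ← transports the regular action `t ↦ e⁻¹(a · e t)`, `η^0 := e⁻¹ 0`, `η^± := e⁻¹ 1`.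
[cite: Mochizuki2012, II Def 2.3 (iii) p.68] -/
theorem nonempty_iff_nonempty_equiv :
    Nonempty (LabCuspStructure C) ↔ Nonempty (LabCuspPM C W.piV W.piPM ≃ ZMod S.l) := by
  constructor
  · rintro ⟨L⟩
    exact ⟨L.toFl⟩
  · rintro ⟨e⟩
    exact ⟨{ act := fun a t => e.symm ((a : ZMod S.l) * e t)
             act_one := fun t => by simp
             act_mul := fun a b t => by simp [mul_assoc]
             eta0 := e.symm 0
             etaPM := e.symm 1
             toFl := e
             toFl_eta0 := by simp
             toFl_etaPM := Or.inl (by simp)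
             toFl_act := fun a t => by simp }⟩

/-- **IUTchII:Def2.3(iii)** / **IUTchI:Def6.1(iii)** (II p.68, I pp.156–157) GENUINE witness RELATIVE TO the kit:
given a bijection `eK : LabCusp^±(Π_v) ≃ LabCusp^±(†𝒟_v)` with abc-iut-L5-t4's kit label set at an isomorph
`X ≅ K.model v` (MERGE-MAP row 99), there is an `L : LabCuspStructure C` ADMITTING a `KitAgreement` along `eK`: its
`toFl` is `eK` followed by a chart of the kit's `𝔽_l^±`-group `K.labPM v X hX` (charts exist: `FlPMGroup.nonempty`),
so — by `LabCuspKitBridge` (`chart_eta0`, `chart_etaPM`, `chart_act`) — its `𝔽_l^×`-action, zero element and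
`±`-canonical element are the ones [IUTchI] Def 6.1 (iii) determines. [cite: Mochizuki2012, I Def 6.1 (iii) pp.156–157] -/
theorem exists_kitAgreement_of_equiv (K : PMBaseKit.{u} S.l) (v : K.V) (X : K.Amb v)
    (hX : Nonempty (X ≅ K.model v)) (eK : LabCuspPM C W.piV W.piPM ≃ K.LabCuspPM v X) :
    ∃ L : LabCuspStructure C, Nonempty (L.KitAgreement K v X hX) := by
  obtain ⟨c, hc⟩ := (K.labPM v X hX).nonempty
  refine ⟨{ act := fun a t => (eK.trans c).symm ((a : ZMod S.l) * (eK.trans c) t)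
            act_one := fun t => by simp
            act_mul := fun a b t => by simp [mul_assoc]
            eta0 := (eK.trans c).symm 0
            etaPM := (eK.trans c).symm 1
            toFl := eK.trans c
            toFl_eta0 := by simp
            toFl_etaPM := Or.inl (by simp)
            toFl_act := fun a t => by simp }, ⟨{ e := eK, chart_mem := ?_ }⟩⟩
  have : eK.symm.trans (eK.trans c) = c := by
    ext t
    simp
  rw [this]
  exact hc

/-- **IUTchII:Def2.3(iii)** (kurims p.68) the row is GENUINELY conditional on `(W, C)`: if the label set
`LabCusp^±(Π_v)` has at most one element (e.g. a cuspidal-inertia notion with a single `Π_v`-class) while `l ≥ 2`,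
then NO `LabCuspStructure C` exists (`toFl` would make `𝔽_l` a subsingleton). [cite: Mochizuki2012, II Def 2.3 (iii) p.68] -/
theorem not_nonempty_of_subsingleton [Subsingleton (LabCuspPM C W.piV W.piPM)] (hl : 2 ≤ S.l) :
    ¬ Nonempty (LabCuspStructure C) := by
  rintro ⟨L⟩
  have h01 : (0 : ZMod S.l) = 1 :=
    L.toFl.symm.injective (Subsingleton.elim _ _)
  have : Fact (1 < S.l) := ⟨by omega⟩
  exact zero_ne_one h01

end LabCuspStructure

end Literature.IUT.HodgeArakelov
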